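import Summits.AtomisticToContinuum.FouriersLaw.Theses.HoelderEscapeProfile
import Literature.MathematicalPhysics.KineticTheory.NewtonianFlowLocal

/-!
# Uniform-oscillation arena for `LocalEnergyHalfHoelder` (stmt-AtomisticToContinuum-16008), part 1/3:
# the one-body Duffing oscillator below the rim

Support file (refuter / crux disprover, load-bearing analysis of the DLR guard of crux
`HoelderEscapeProfile.LocalEnergyHalfHoelder`; see part 3/3 `FalseWithoutGibbs.lean` for the full
account). Contents, all proved, no named facts: the one-body force `F(q) = -U'(q)`,
`U(q) = ω₂q²/2 + lam q⁴/4`, on `Fin 1 → ℝ`; its cut-off Newtonian flow `Φ` (tree: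
`NewtonianFlow.cutoffFlow`, cut-off inactive on `|q| ≤ 1`); the cut-off force is a gradient in one
degree of freedom (`Vt = ∫(-g)`), its energy is conserved (`Ht_Φ`); below the rim `U(1)` the position
stays in `(-1, 1)`, so the shell `{p²/2 + U(q) < U(1)}` is invariant, carries true Duffing orbits and
the true energy is conserved on it (`shell_invariant`); the shell is open, bounded, of positive finite
volume; Liouville restricted to the shell (`measurePreserving_Φ_restrict`, from the tree's
`IsSolutionFamily.measurePreserving`) and momentum reversal (`rev1`).
-/

noncomputable section

open MeasureTheory Filter Set Metric
open scoped NNReal ENNReal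

namespace Summit.AtomisticToContinuum.FouriersLaw.Theorems.LocalEnergyHalfHoelder.Negative.UniformOscillationFlow

open Literature.MathematicalPhysics.KineticTheory
open Literature.MathematicalPhysics.KineticTheory.HeatConduction
open Literature.MathematicalPhysics.KineticTheory.NewtonianFlow

/-- The constant vector of `Fin 1 → ℝ` with value `x`. [folklore] -/
def vec (x : ℝ) : Fin 1 → ℝ := fun _ => x

/-- Auxiliary (`vec_apply`), see the module docstring. [folklore] -/
@[simp] theorem vec_apply (x : ℝ) (i : Fin 1) : vec x i = x := rfl

/-- Auxiliary (`eq_vec`), see the module docstring. [folklore] -/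
theorem eq_vec (q : Fin 1 → ℝ) : q = vec (q 0) := by
  funext i; rw [Subsingleton.elim i 0]; rfl

/-- Auxiliary (`norm_vec`), see the module docstring. [folklore] -/
theorem norm_vec (x : ℝ) : ‖vec x‖ = |x| := by
  refine le_antisymm ((pi_norm_le_iff_of_nonneg (abs_nonneg x)).mpr fun i => ?_) ?_
  · simp [Real.norm_eq_abs]
  · simpa [Real.norm_eq_abs] using norm_le_pi_norm (vec x) 0

/-- Auxiliary (`continuous_vec`), see the module docstring. [folklore] -/
theorem continuous_vec : Continuous vec := continuous_pi fun _ => continuous_id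

variable (ω₂ lam : ℝ)

/-- The pinning potential `U(x) = ω₂ x²/2 + lam x⁴/4` of `pinnedChain`. [folklore] -/
def Upin (x : ℝ) : ℝ := ω₂ * x ^ 2 / 2 + lam * x ^ 4 / 4

/-- Auxiliary (`hasDerivAt_Upin`), see the module docstring. [folklore] -/
theorem hasDerivAt_Upin (x : ℝ) : HasDerivAt (Upin ω₂ lam) (ω₂ * x + lam * x ^ 3) x := by
  have h : HasDerivAt (Upin ω₂ lam)
      (ω₂ * (↑(2:ℕ) * x ^ (2 - 1)) / 2 + lam * (↑(4:ℕ) * x ^ (4 - 1)) / 4) x :=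
    (((hasDerivAt_pow 2 x).const_mul ω₂).div_const 2).add
      (((hasDerivAt_pow 4 x).const_mul lam).div_const 4)
  refine h.congr_deriv ?_
  push_cast
  ring

/-- Auxiliary (`continuous_Upin`), see the module docstring. [folklore] -/
theorem continuous_Upin : Continuous (Upin ω₂ lam) := by
  unfold Upin; fun_prop

/-- Auxiliary (`Upin_zero`), see the module docstring. [folklore] -/
@[simp] theorem Upin_zero : Upin ω₂ lam 0 = 0 := by simp [Upin]

/-- Auxiliary (`Upin_neg`), see the module docstring. [folklore] -/
theorem Upin_neg (x : ℝ) : Upin ω₂ lam (-x) = Upin ω₂ lam x := by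
  simp [Upin, even_two.neg_pow, show Even 4 by decide, Even.neg_pow]

/-- Above the rim: `|x| ≥ 1 ⇒ U(1) ≤ U(x)` (for `ω₂, lam ≥ 0`). [folklore] -/
theorem Upin_one_le {ω₂ lam : ℝ} (hω : 0 ≤ ω₂) (hl : 0 ≤ lam) {x : ℝ} (hx : 1 ≤ |x|) :
    Upin ω₂ lam 1 ≤ Upin ω₂ lam x := by
  have h2 : 1 ≤ x ^ 2 := by
    have := sq_abs x; nlinarith [abs_nonneg x]
  have h4 : 1 ≤ x ^ 4 := by nlinarith
  simp only [Upin, one_pow, mul_one]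
  nlinarith [mul_le_mul_of_nonneg_left h2 hω, mul_le_mul_of_nonneg_left h4 hl]

/-- Auxiliary (`abs_lt_one_of_Upin_lt`), see the module docstring. [folklore] -/
theorem abs_lt_one_of_Upin_lt {ω₂ lam : ℝ} (hω : 0 ≤ ω₂) (hl : 0 ≤ lam) {x : ℝ}
    (hx : Upin ω₂ lam x < Upin ω₂ lam 1) : |x| < 1 := by
  by_contra h
  exact absurd (Upin_one_le hω hl (not_lt.mp h)) (not_le.mpr hx)

/-- The one-body force of the pinning potential, `F(q) = -U'(q) = -(ω₂ q + lam q³)`, on `Fin 1 → ℝ`. [folklore] -/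
def duffingForce (q : Fin 1 → ℝ) : Fin 1 → ℝ := fun _ => -(ω₂ * q 0 + lam * q 0 ^ 3)

/-- Auxiliary (`contDiff_duffingForce`), see the module docstring. [folklore] -/
theorem contDiff_duffingForce : ContDiff ℝ 1 (duffingForce ω₂ lam) := by
  unfold duffingForce
  refine contDiff_pi.mpr fun _ => ?_
  have h0 : ContDiff ℝ 1 (fun q : Fin 1 → ℝ => q 0) := contDiff_apply ℝ ℝ 0
  exact ((contDiff_const.mul h0).add (contDiff_const.mul (h0.pow 3))).neg

/-- The cut-off one-body flow (cut-off radius `n = 0`, i.e. the force is untouched on `|q| ≤ 1`). [folklore] -/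
def Φ : ℝ → PhaseSpace 1 → PhaseSpace 1 := cutoffFlow (contDiff_duffingForce ω₂ lam) 0

/-- Auxiliary (`isFlow_Φ`), see the module docstring. [folklore] -/
theorem isFlow_Φ : IsFlow (cutoff 0 (duffingForce ω₂ lam)) (Φ ω₂ lam) :=
  isFlow_cutoffFlow _ 0

/-- The scalar cut-off force. [folklore] -/
def g (x : ℝ) : ℝ := (cutoff 0 (duffingForce ω₂ lam) (vec x)) 0

/-- Auxiliary (`cutoff_apply_eq_g`), see the module docstring. [folklore] -/
theorem cutoff_apply_eq_g (q : Fin 1 → ℝ) : (cutoff 0 (duffingForce ω₂ lam) q) 0 = g ω₂ lam (q 0) := by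
  rw [eq_vec q]; rfl

/-- Auxiliary (`g_formula`), see the module docstring. [folklore] -/
theorem g_formula (x : ℝ) : g ω₂ lam x = (bump 1 0) (vec x) * (-(ω₂ * x + lam * x ^ 3)) := by
  simp [g, cutoff, duffingForce, smul_eq_mul]

/-- Auxiliary (`g_eq_of_abs_le`), see the module docstring. [folklore] -/
theorem g_eq_of_abs_le {x : ℝ} (hx : |x| ≤ 1) : g ω₂ lam x = -(ω₂ * x + lam * x ^ 3) := by
  have h : ‖vec x‖ ≤ (0:ℕ) + 1 := by rw [norm_vec]; simpa using hx
  simp [g, cutoff_eq_of_norm_le (duffingForce ω₂ lam) h, duffingForce]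

/-- Auxiliary (`continuous_g`), see the module docstring. [folklore] -/
theorem continuous_g : Continuous (g ω₂ lam) := by
  unfold g
  exact (continuous_apply 0).comp ((continuous_cutoff (contDiff_duffingForce ω₂ lam)).comp continuous_vec)

/-- Auxiliary (`neg_g_nonneg`), see the module docstring. [folklore] -/
theorem neg_g_nonneg {ω₂ lam : ℝ} (hω : 0 ≤ ω₂) (hl : 0 ≤ lam) {s : ℝ} (hs : 0 ≤ s) : 0 ≤ -g ω₂ lam s := by
  rw [g_formula]
  have hb : 0 ≤ (bump 1 0) (vec s) := (bump 1 0).nonneg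
  have : 0 ≤ ω₂ * s + lam * s ^ 3 := by positivity
  nlinarith

/-- Auxiliary (`neg_g_nonpos`), see the module docstring. [folklore] -/
theorem neg_g_nonpos {ω₂ lam : ℝ} (hω : 0 ≤ ω₂) (hl : 0 ≤ lam) {s : ℝ} (hs : s ≤ 0) : -g ω₂ lam s ≤ 0 := by
  rw [g_formula]
  have hb : 0 ≤ (bump 1 0) (vec s) := (bump 1 0).nonneg
  have h3 : s ^ 3 ≤ 0 := by
    have : s ^ 3 = s * s ^ 2 := by ring
    rw [this]; exact mul_nonpos_of_nonpos_of_nonneg hs (sq_nonneg s)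
  have : ω₂ * s + lam * s ^ 3 ≤ 0 := by nlinarith [mul_nonpos_of_nonneg_of_nonpos hω hs, mul_nonpos_of_nonneg_of_nonpos hl h3]
  nlinarith

/-- The potential of the cut-off force, `Ṽ(x) = ∫₀ˣ (-g)`. [folklore] -/
def Vt (x : ℝ) : ℝ := ∫ s in (0:ℝ)..x, -g ω₂ lam s

/-- Auxiliary (`hasDerivAt_Vt`), see the module docstring. [folklore] -/
theorem hasDerivAt_Vt (x : ℝ) : HasDerivAt (Vt ω₂ lam) (-g ω₂ lam x) x :=
  ((continuous_g ω₂ lam).neg.integral_hasStrictDerivAt 0 x).hasDerivAt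

/-- Auxiliary (`Vt_eq_Upin`), see the module docstring. [folklore] -/
theorem Vt_eq_Upin {x : ℝ} (hx : |x| ≤ 1) : Vt ω₂ lam x = Upin ω₂ lam x := by
  unfold Vt
  have hcongr : ∫ s in (0:ℝ)..x, -g ω₂ lam s = ∫ s in (0:ℝ)..x, (ω₂ * s + lam * s ^ 3) := by
    refine intervalIntegral.integral_congr fun s hs => ?_
    have hx' := abs_le.mp hx
    have hs' : |s| ≤ 1 := by
      rcases Set.mem_uIcc.mp hs with ⟨h1, h2⟩ | ⟨h1, h2⟩
      · exact abs_le.mpr ⟨by linarith, by linarith⟩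
      · exact abs_le.mpr ⟨by linarith, by linarith⟩
    simp [g_eq_of_abs_le ω₂ lam hs']
  have hcont : Continuous fun s : ℝ => ω₂ * s + lam * s ^ 3 := by fun_prop
  rw [hcongr, intervalIntegral.integral_eq_sub_of_hasDerivAt (fun s _ => hasDerivAt_Upin ω₂ lam s)
    (hcont.intervalIntegrable _ _)]
  simp

/-- Auxiliary (`Upin_one_le_Vt_of_one_le`), see the module docstring. [folklore] -/
theorem Upin_one_le_Vt_of_one_le {ω₂ lam : ℝ} (hω : 0 ≤ ω₂) (hl : 0 ≤ lam) {x : ℝ} (hx : 1 ≤ x) :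
    Upin ω₂ lam 1 ≤ Vt ω₂ lam x := by
  have hi : ∀ a b : ℝ, IntervalIntegrable (fun s => -g ω₂ lam s) volume a b :=
    fun a b => (continuous_g ω₂ lam).neg.intervalIntegrable a b
  have hsplit : Vt ω₂ lam x = Vt ω₂ lam 1 + ∫ s in (1:ℝ)..x, -g ω₂ lam s := by
    unfold Vt; rw [intervalIntegral.integral_add_adjacent_intervals (hi 0 1) (hi 1 x)]
  have h1 : Vt ω₂ lam 1 = Upin ω₂ lam 1 := Vt_eq_Upin ω₂ lam (by simp)
  have hnn : 0 ≤ ∫ s in (1:ℝ)..x, -g ω₂ lam s :=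
    intervalIntegral.integral_nonneg hx fun s hs => neg_g_nonneg hω hl (by linarith [hs.1])
  linarith

/-- Auxiliary (`Upin_one_le_Vt_of_le_neg_one`), see the module docstring. [folklore] -/
theorem Upin_one_le_Vt_of_le_neg_one {ω₂ lam : ℝ} (hω : 0 ≤ ω₂) (hl : 0 ≤ lam) {x : ℝ} (hx : x ≤ -1) :
    Upin ω₂ lam 1 ≤ Vt ω₂ lam x := by
  have hi : ∀ a b : ℝ, IntervalIntegrable (fun s => -g ω₂ lam s) volume a b :=
    fun a b => (continuous_g ω₂ lam).neg.intervalIntegrable a b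
  have hsplit : Vt ω₂ lam (-1) = Vt ω₂ lam x + ∫ s in x..(-1:ℝ), -g ω₂ lam s := by
    unfold Vt; rw [intervalIntegral.integral_add_adjacent_intervals (hi 0 x) (hi x (-1))]
  have h1 : Vt ω₂ lam (-1) = Upin ω₂ lam 1 := by
    rw [Vt_eq_Upin ω₂ lam (by simp), Upin_neg]
  have hnp : ∫ s in x..(-1:ℝ), -g ω₂ lam s ≤ 0 := by
    have : ∫ s in x..(-1:ℝ), -g ω₂ lam s = -∫ s in x..(-1:ℝ), - -g ω₂ lam s := by
      rw [← intervalIntegral.integral_neg]; simp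
    rw [this, neg_nonpos]
    exact intervalIntegral.integral_nonneg hx fun s hs => by
      have := neg_g_nonpos hω hl (show s ≤ 0 by linarith [hs.2]); linarith
  linarith

/-- Confinement: below the rim the position stays in `(-1, 1)`. [folklore] -/
theorem abs_lt_one_of_Vt_lt {ω₂ lam : ℝ} (hω : 0 ≤ ω₂) (hl : 0 ≤ lam) {x : ℝ}
    (hx : Vt ω₂ lam x < Upin ω₂ lam 1) : |x| < 1 := by
  by_contra h
  rw [not_lt] at h
  rcases le_abs'.mp h with h' | h'
  · exact absurd (Upin_one_le_Vt_of_le_neg_one hω hl h') (not_le.mpr hx)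
  · exact absurd (Upin_one_le_Vt_of_one_le hω hl h') (not_le.mpr hx)

/-- The one-body energy `H(q, p) = p²/2 + U(q)` and its cut-off twin. [folklore] -/
def Hd (z : PhaseSpace 1) : ℝ := (z.2 0) ^ 2 / 2 + Upin ω₂ lam (z.1 0)

/-- Auxiliary (`Ht`), see the module docstring. [folklore] -/
def Ht (z : PhaseSpace 1) : ℝ := (z.2 0) ^ 2 / 2 + Vt ω₂ lam (z.1 0)

/-- Auxiliary (`continuous_Hd`), see the module docstring. [folklore] -/
theorem continuous_Hd : Continuous (Hd ω₂ lam) := by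
  unfold Hd
  exact (((continuous_apply 0).comp continuous_snd).pow 2 |>.div_const 2).add
    ((continuous_Upin ω₂ lam).comp ((continuous_apply 0).comp continuous_fst))

/-- Components of the cut-off flow curves. [folklore] -/
theorem hasDerivAt_Φ_fst (z : PhaseSpace 1) (t : ℝ) :
    HasDerivAt (fun s => (Φ ω₂ lam s z).1 0) ((Φ ω₂ lam t z).2 0) t :=
  (hasDerivAt_pi.mp ((isFlow_Φ ω₂ lam).hasDerivAt_fst z t)) 0

/-- Auxiliary (`hasDerivAt_Φ_snd`), see the module docstring. [folklore] -/
theorem hasDerivAt_Φ_snd (z : PhaseSpace 1) (t : ℝ) :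
    HasDerivAt (fun s => (Φ ω₂ lam s z).2 0) (g ω₂ lam ((Φ ω₂ lam t z).1 0)) t := by
  have h := (hasDerivAt_pi.mp ((isFlow_Φ ω₂ lam).hasDerivAt_snd z t)) 0
  rwa [cutoff_apply_eq_g] at h

/-- Conservation of the cut-off energy along the cut-off flow. [folklore] -/
theorem Ht_Φ (z : PhaseSpace 1) (t : ℝ) : Ht ω₂ lam (Φ ω₂ lam t z) = Ht ω₂ lam z := by
  have hE : ∀ s, HasDerivAt (fun u => Ht ω₂ lam (Φ ω₂ lam u z)) 0 s := by
    intro s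
    have h1 := hasDerivAt_Φ_fst ω₂ lam z s
    have h2 := hasDerivAt_Φ_snd ω₂ lam z s
    have h3 : HasDerivAt (fun u => Vt ω₂ lam ((Φ ω₂ lam u z).1 0))
        (-g ω₂ lam ((Φ ω₂ lam s z).1 0) * ((Φ ω₂ lam s z).2 0)) s :=
      (hasDerivAt_Vt ω₂ lam _).comp s h1
    have h4 : HasDerivAt (fun u => ((Φ ω₂ lam u z).2 0) ^ 2 / 2)
        (↑(2:ℕ) * ((Φ ω₂ lam s z).2 0) ^ (2 - 1) * g ω₂ lam ((Φ ω₂ lam s z).1 0) / 2) s :=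
      (h2.pow 2).div_const 2
    have h5 := h4.add h3
    have h6 : (↑(2:ℕ) * ((Φ ω₂ lam s z).2 0) ^ (2 - 1) * g ω₂ lam ((Φ ω₂ lam s z).1 0) / 2 +
        -g ω₂ lam ((Φ ω₂ lam s z).1 0) * ((Φ ω₂ lam s z).2 0)) = 0 := by
      push_cast; ring
    exact h5.congr_deriv h6
  have hdiff : Differentiable ℝ (fun u => Ht ω₂ lam (Φ ω₂ lam u z)) := fun s => (hE s).differentiableAt
  have h := is_const_of_deriv_eq_zero hdiff (fun s => (hE s).deriv) t 0
  simpa [(isFlow_Φ ω₂ lam).2.1 z] using h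

/-- The energy shell below the rim is invariant, the true energy is conserved on it, and the
position stays in `(-1, 1)`. [folklore] -/
theorem shell_invariant {ω₂ lam : ℝ} (hω : 0 ≤ ω₂) (hl : 0 ≤ lam) {z : PhaseSpace 1}
    (hz : Hd ω₂ lam z < Upin ω₂ lam 1) (t : ℝ) :
    Hd ω₂ lam (Φ ω₂ lam t z) = Hd ω₂ lam z ∧ |(Φ ω₂ lam t z).1 0| < 1 := by
  have hq0 : |z.1 0| < 1 := by
    refine abs_lt_one_of_Upin_lt hω hl (lt_of_le_of_lt ?_ hz)
    have : 0 ≤ (z.2 0) ^ 2 / 2 := by positivity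
    unfold Hd; linarith
  have hHt0 : Ht ω₂ lam z = Hd ω₂ lam z := by
    unfold Ht Hd; rw [Vt_eq_Upin ω₂ lam hq0.le]
  have hcons : Ht ω₂ lam (Φ ω₂ lam t z) = Hd ω₂ lam z := by rw [Ht_Φ, hHt0]
  have hqt : |(Φ ω₂ lam t z).1 0| < 1 := by
    refine abs_lt_one_of_Vt_lt hω hl (lt_of_le_of_lt ?_ (hcons ▸ hz))
    have : 0 ≤ ((Φ ω₂ lam t z).2 0) ^ 2 / 2 := by positivity
    unfold Ht; linarith
  refine ⟨?_, hqt⟩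
  rw [← hcons]
  unfold Ht Hd; rw [Vt_eq_Upin ω₂ lam hqt.le]


/-! ### Auxiliary facts on the shell -/

variable {ω₂ lam}

/-- Auxiliary (`abs_fst_lt_one_of_Hd_lt`), see the module docstring. [folklore] -/
theorem abs_fst_lt_one_of_Hd_lt (hω : 0 ≤ ω₂) (hl : 0 ≤ lam) {z : PhaseSpace 1}
    (hz : Hd ω₂ lam z < Upin ω₂ lam 1) : |z.1 0| < 1 := by
  refine abs_lt_one_of_Upin_lt hω hl (lt_of_le_of_lt ?_ hz)
  have : 0 ≤ (z.2 0) ^ 2 / 2 := by positivity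
  unfold Hd; linarith

/-- Auxiliary (`Upin_nonneg`), see the module docstring. [folklore] -/
theorem Upin_nonneg (hω : 0 ≤ ω₂) (hl : 0 ≤ lam) (x : ℝ) : 0 ≤ Upin ω₂ lam x := by
  unfold Upin; positivity

/-- Auxiliary (`abs_snd_le_of_Hd_lt`), see the module docstring. [folklore] -/
theorem abs_snd_le_of_Hd_lt (hω : 0 ≤ ω₂) (hl : 0 ≤ lam) {z : PhaseSpace 1}
    (hz : Hd ω₂ lam z < Upin ω₂ lam 1) : |z.2 0| ≤ Real.sqrt (2 * Upin ω₂ lam 1) := by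
  apply Real.abs_le_sqrt
  have := Upin_nonneg hω hl (z.1 0)
  unfold Hd at hz; linarith

variable (ω₂ lam)

/-- The energy shell below the rim `U(1)`. [folklore] -/
def shell : Set (PhaseSpace 1) := {z | Hd ω₂ lam z < Upin ω₂ lam 1}

/-- Auxiliary (`isOpen_shell`), see the module docstring. [folklore] -/
theorem isOpen_shell : IsOpen (shell ω₂ lam) :=
  isOpen_lt (continuous_Hd ω₂ lam) continuous_const

/-- Auxiliary (`measurableSet_shell`), see the module docstring. [folklore] -/
theorem measurableSet_shell : MeasurableSet (shell ω₂ lam) := (isOpen_shell ω₂ lam).measurableSet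

variable {ω₂ lam}

/-- Auxiliary (`Upin_one_pos`), see the module docstring. [folklore] -/
theorem Upin_one_pos (hω : 0 < ω₂) (hl : 0 ≤ lam) : 0 < Upin ω₂ lam 1 := by
  unfold Upin; positivity

/-- Auxiliary (`zero_mem_shell`), see the module docstring. [folklore] -/
theorem zero_mem_shell (hω : 0 < ω₂) (hl : 0 ≤ lam) : (0 : PhaseSpace 1) ∈ shell ω₂ lam := by
  show ((0 : PhaseSpace 1).2 0) ^ 2 / 2 + Upin ω₂ lam ((0 : PhaseSpace 1).1 0) < Upin ω₂ lam 1
  simpa using Upin_one_pos hω hl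

/-- Auxiliary (`shell_subset_closedBall`), see the module docstring. [folklore] -/
theorem shell_subset_closedBall (hω : 0 ≤ ω₂) (hl : 0 ≤ lam) :
    shell ω₂ lam ⊆ closedBall (0 : PhaseSpace 1) (max 1 (Real.sqrt (2 * Upin ω₂ lam 1))) := by
  intro z hz
  rw [mem_closedBall, dist_zero_right, Prod.norm_def, eq_vec z.1, eq_vec z.2, norm_vec, norm_vec]
  exact max_le_max (abs_fst_lt_one_of_Hd_lt hω hl hz).le (abs_snd_le_of_Hd_lt hω hl hz)

/-- Auxiliary (`volume_shell_ne_top`), see the module docstring. [folklore] -/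
theorem volume_shell_ne_top (hω : 0 ≤ ω₂) (hl : 0 ≤ lam) : volume (shell ω₂ lam) ≠ ∞ :=
  ((measure_mono (shell_subset_closedBall hω hl)).trans_lt measure_closedBall_lt_top).ne

/-- Auxiliary (`volume_shell_ne_zero`), see the module docstring. [folklore] -/
theorem volume_shell_ne_zero (hω : 0 < ω₂) (hl : 0 ≤ lam) : volume (shell ω₂ lam) ≠ 0 :=
  ((isOpen_shell ω₂ lam).measure_pos volume ⟨0, zero_mem_shell hω hl⟩).ne'

/-- Auxiliary (`Φ_mem_shell`), see the module docstring. [folklore] -/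
theorem Φ_mem_shell (hω : 0 ≤ ω₂) (hl : 0 ≤ lam) {z : PhaseSpace 1} (hz : z ∈ shell ω₂ lam) (t : ℝ) :
    Φ ω₂ lam t z ∈ shell ω₂ lam := by
  show Hd ω₂ lam (Φ ω₂ lam t z) < Upin ω₂ lam 1
  rw [(shell_invariant hω hl hz t).1]; exact hz

/-- Auxiliary (`contDiff_cut`), see the module docstring. [folklore] -/
theorem contDiff_cut : ContDiff ℝ 1 (cutoff 0 (duffingForce ω₂ lam)) :=
  contDiff_cutoff (contDiff_duffingForce ω₂ lam)

/-- Auxiliary (`isSolutionFamily_Φ`), see the module docstring. [folklore] -/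
theorem isSolutionFamily_Φ : IsSolutionFamily (cutoff 0 (duffingForce ω₂ lam)) (Φ ω₂ lam) :=
  (isFlow_Φ ω₂ lam).isSolutionFamily

/-- Auxiliary (`preimage_Φ_shell`), see the module docstring. [folklore] -/
theorem preimage_Φ_shell (hω : 0 ≤ ω₂) (hl : 0 ≤ lam) (t : ℝ) :
    (Φ ω₂ lam t) ⁻¹' (shell ω₂ lam) = shell ω₂ lam := by
  ext z
  simp only [mem_preimage]
  constructor
  · intro h
    have h1 := Φ_mem_shell hω hl h (-t)
    rwa [isSolutionFamily_Φ.neg_apply_apply contDiff_cut] at h1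
  · intro h; exact Φ_mem_shell hω hl h t

/-- Auxiliary (`measurable_Φ`), see the module docstring. [folklore] -/
theorem measurable_Φ (t : ℝ) : Measurable (Φ ω₂ lam t) :=
  ((isFlow_Φ ω₂ lam).continuous_apply t).measurable

/-- Liouville on the shell: the cut-off flow preserves Lebesgue measure restricted to the shell. [folklore] -/
theorem measurePreserving_Φ_restrict (hω : 0 ≤ ω₂) (hl : 0 ≤ lam) (t : ℝ) :
    MeasurePreserving (Φ ω₂ lam t) (volume.restrict (shell ω₂ lam)) (volume.restrict (shell ω₂ lam)) := by
  have h0 : MeasurePreserving (Φ ω₂ lam t) volume volume :=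
    (isSolutionFamily_Φ (ω₂ := ω₂) (lam := lam)).measurePreserving contDiff_cut t
  have h := h0.restrict_preimage (measurableSet_shell ω₂ lam)
  rwa [preimage_Φ_shell hω hl t] at h

/-- Momentum reversal on the one-body phase space. [folklore] -/
def rev1 (z : PhaseSpace 1) : PhaseSpace 1 := (z.1, -z.2)

/-- Auxiliary (`measurable_rev1`), see the module docstring. [folklore] -/
theorem measurable_rev1 : Measurable (rev1) := measurable_fst.prodMk measurable_snd.neg

/-- Auxiliary (`measurePreserving_rev1`), see the module docstring. [folklore] -/
theorem measurePreserving_rev1 : MeasurePreserving rev1 (volume : Measure (PhaseSpace 1)) volume :=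
  (MeasurePreserving.id (volume : Measure (Fin 1 → ℝ))).prod (Measure.measurePreserving_neg _)

/-- Auxiliary (`preimage_rev1_shell`), see the module docstring. [folklore] -/
theorem preimage_rev1_shell : rev1 ⁻¹' (shell ω₂ lam) = shell ω₂ lam := by
  ext z; simp [shell, Hd, rev1]

/-- Auxiliary (`measurePreserving_rev1_restrict`), see the module docstring. [folklore] -/
theorem measurePreserving_rev1_restrict :
    MeasurePreserving rev1 (volume.restrict (shell ω₂ lam)) (volume.restrict (shell ω₂ lam)) := by
  have h := measurePreserving_rev1.restrict_preimage (measurableSet_shell ω₂ lam)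
  rwa [preimage_rev1_shell] at h


end Summit.AtomisticToContinuum.FouriersLaw.Theorems.LocalEnergyHalfHoelder.Negative.UniformOscillationFlow

end
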